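import Summits.Ventures.PercRepro.CoreCountWrapper

/-!
# PercRepro — subsets of a given weight (p2, gen 12)

A pure counting lemma for the series-class bounds of `CoreFourClasses`: for a finset `R` with weights `a ≥ 1`, the
subsets of weight `3` are `(1,1,1)`, `(1,2)` or `(3)`, the subsets of weight `4` are `(1,1,1,1)`, `(1,1,2)`, `(2,2)`,
`(1,3)` or `(4)`; writing `σ, t₂, t₃, t₄` for the numbers of elements of weight `1, 2, 3, 4`:

  `#{T ⊆ R : Σ a = 3} ≤ C(σ,3) + σ·t₂ + t₃`,   `#{T ⊆ R : Σ a = 4} ≤ C(σ,4) + C(σ,2)·t₂ + C(t₂,2) + σ·t₃ + t₄`.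

* `card_weight_three_le`, `card_weight_four_le`.
Imports `CoreCountWrapper` (Mathlib only is used). Axioms: standard.
-/

namespace PercRepro
namespace CoreFour

open Finset

variable {α : Type}

/-! ### The weight counts -/

/-- A subset of weight `3` (weights `≥ 1`) is three weight-`1` elements, a weight-`1` and a weight-`2` element, or one
weight-`3` element: `#{T ⊆ R : Σ a = 3} ≤ C(σ,3) + σ·t₂ + t₃`. -/
theorem card_weight_three_le (Rf : Finset α) (a : α → ℕ) (ha : ∀ r ∈ Rf, 1 ≤ a r) :
    (Rf.powerset.filter (fun T => ∑ r ∈ T, a r = 3)).card ≤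
      (Rf.filter (fun r => a r = 1)).card.choose 3 +
        (Rf.filter (fun r => a r = 1)).card * (Rf.filter (fun r => a r = 2)).card +
        (Rf.filter (fun r => a r = 3)).card := by
  classical
  set R₁ := Rf.filter (fun r => a r = 1) with hR₁
  set R₂ := Rf.filter (fun r => a r = 2) with hR₂
  set R₃ := Rf.filter (fun r => a r = 3) with hR₃
  have hsub : Rf.powerset.filter (fun T => ∑ r ∈ T, a r = 3) ⊆
      (Finset.powersetCard 3 R₁ ∪ (R₁ ×ˢ R₂).image (fun p : α × α => ({p.1, p.2} : Finset α))) ∪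
        R₃.image (fun z => ({z} : Finset α)) := by
    intro T hT
    rw [Finset.mem_filter, Finset.mem_powerset] at hT
    obtain ⟨hTR, hTsum⟩ := hT
    have hTa : ∀ r ∈ T, 1 ≤ a r := fun r hr => ha r (hTR hr)
    have hcard : T.card ≤ 3 := by
      have h := Finset.card_nsmul_le_sum T a 1 hTa
      rw [smul_eq_mul, mul_one, hTsum] at h
      exact h
    have hpos : 0 < T.card := by
      rw [Finset.card_pos, Finset.nonempty_iff_ne_empty]
      rintro rfl
      simp at hTsum
    rw [Finset.mem_union, Finset.mem_union]
    rcases (show T.card = 1 ∨ T.card = 2 ∨ T.card = 3 by omega) with h1 | h2 | h3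
    · -- `T = {z}`, `a z = 3`
      obtain ⟨z, rfl⟩ := Finset.card_eq_one.1 h1
      rw [Finset.sum_singleton] at hTsum
      right
      rw [Finset.mem_image]
      exact ⟨z, Finset.mem_filter.2 ⟨hTR (Finset.mem_singleton_self z), hTsum⟩, rfl⟩
    · -- `T = {x, y}`, `{a x, a y} = {1, 2}`
      obtain ⟨x, y, hxy, rfl⟩ := Finset.card_eq_two.1 h2
      rw [Finset.sum_pair hxy] at hTsum
      have hx1 := hTa x (by simp)
      have hy1 := hTa y (by simp)
      have hxR : x ∈ Rf := hTR (by simp)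
      have hyR : y ∈ Rf := hTR (by simp)
      left; right
      rw [Finset.mem_image]
      rcases (show (a x = 1 ∧ a y = 2) ∨ (a x = 2 ∧ a y = 1) by omega) with ⟨hx, hy⟩ | ⟨hx, hy⟩
      · exact ⟨(x, y), Finset.mem_product.2 ⟨Finset.mem_filter.2 ⟨hxR, hx⟩, Finset.mem_filter.2 ⟨hyR, hy⟩⟩, rfl⟩
      · exact ⟨(y, x), Finset.mem_product.2 ⟨Finset.mem_filter.2 ⟨hyR, hy⟩, Finset.mem_filter.2 ⟨hxR, hx⟩⟩,
          by simp only; rw [Finset.pair_comm]⟩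
    · -- `T = {x, y, z}`, all weights `1`
      left; left
      rw [Finset.mem_powersetCard]
      refine ⟨?_, h3⟩
      intro r hr
      have hr1 := hTa r hr
      have hle : a r ≤ 1 := by
        -- the other two elements contribute `≥ 2`
        have h := Finset.card_nsmul_le_sum (T.erase r) a 1 (fun s hs => hTa s (Finset.mem_of_mem_erase hs))
        rw [smul_eq_mul, mul_one, Finset.card_erase_of_mem hr, h3] at h
        have h' : 2 ≤ ∑ x ∈ T.erase r, a x := h
        have hsplit : a r + ∑ x ∈ T.erase r, a x = ∑ x ∈ T, a x := Finset.add_sum_erase T a hr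
        omega
      exact Finset.mem_filter.2 ⟨hTR hr, by omega⟩
  calc (Rf.powerset.filter (fun T => ∑ r ∈ T, a r = 3)).card
      ≤ ((Finset.powersetCard 3 R₁ ∪ (R₁ ×ˢ R₂).image (fun p : α × α => ({p.1, p.2} : Finset α))) ∪
          R₃.image (fun z => ({z} : Finset α))).card := Finset.card_le_card hsub
    _ ≤ (Finset.powersetCard 3 R₁ ∪ (R₁ ×ˢ R₂).image (fun p : α × α => ({p.1, p.2} : Finset α))).card +
          (R₃.image (fun z => ({z} : Finset α))).card := Finset.card_union_le _ _
    _ ≤ ((Finset.powersetCard 3 R₁).card + ((R₁ ×ˢ R₂).image (fun p : α × α => ({p.1, p.2} : Finset α))).card) +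
          (R₃.image (fun z => ({z} : Finset α))).card := by gcongr; exact Finset.card_union_le _ _
    _ ≤ (R₁.card.choose 3 + (R₁ ×ˢ R₂).card) + R₃.card := by
        gcongr
        · rw [Finset.card_powersetCard]
        · exact Finset.card_image_le
        · exact Finset.card_image_le
    _ = _ := by rw [Finset.card_product]

/-- A subset of weight `4` (weights `≥ 1`) is `(1,1,1,1)`, `(1,1,2)`, `(2,2)`, `(1,3)` or `(4)`:
`#{T ⊆ R : Σ a = 4} ≤ C(σ,4) + C(σ,2)·t₂ + C(t₂,2) + σ·t₃ + t₄`. -/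
theorem card_weight_four_le (Rf : Finset α) (a : α → ℕ) (ha : ∀ r ∈ Rf, 1 ≤ a r) :
    (Rf.powerset.filter (fun T => ∑ r ∈ T, a r = 4)).card ≤
      (Rf.filter (fun r => a r = 1)).card.choose 4 +
        (Rf.filter (fun r => a r = 1)).card.choose 2 * (Rf.filter (fun r => a r = 2)).card +
        (Rf.filter (fun r => a r = 2)).card.choose 2 +
        (Rf.filter (fun r => a r = 1)).card * (Rf.filter (fun r => a r = 3)).card +
        (Rf.filter (fun r => a r = 4)).card := by
  classical
  set R₁ := Rf.filter (fun r => a r = 1) with hR₁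
  set R₂ := Rf.filter (fun r => a r = 2) with hR₂
  set R₃ := Rf.filter (fun r => a r = 3) with hR₃
  set R₄ := Rf.filter (fun r => a r = 4) with hR₄
  set A := Finset.powersetCard 4 R₁ with hA
  set B := (Finset.powersetCard 2 R₁ ×ˢ R₂).image (fun p : Finset α × α => insert p.2 p.1) with hB
  set D := Finset.powersetCard 2 R₂ with hD
  set F := (R₁ ×ˢ R₃).image (fun p : α × α => ({p.1, p.2} : Finset α)) with hF
  set G := R₄.image (fun z => ({z} : Finset α)) with hG
  have hsub : Rf.powerset.filter (fun T => ∑ r ∈ T, a r = 4) ⊆ (((A ∪ B) ∪ D) ∪ F) ∪ G := by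
    intro T hT
    rw [Finset.mem_filter, Finset.mem_powerset] at hT
    obtain ⟨hTR, hTsum⟩ := hT
    have hTa : ∀ r ∈ T, 1 ≤ a r := fun r hr => ha r (hTR hr)
    have hcard : T.card ≤ 4 := by
      have h := Finset.card_nsmul_le_sum T a 1 hTa
      rw [smul_eq_mul, mul_one, hTsum] at h
      exact h
    have hpos : 0 < T.card := by
      rw [Finset.card_pos, Finset.nonempty_iff_ne_empty]
      rintro rfl
      simp at hTsum
    simp only [Finset.mem_union]
    rcases (show T.card = 1 ∨ T.card = 2 ∨ T.card = 3 ∨ T.card = 4 by omega) with h1 | h2 | h3 | h4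
    · -- `{z}`, `a z = 4`
      obtain ⟨z, rfl⟩ := Finset.card_eq_one.1 h1
      rw [Finset.sum_singleton] at hTsum
      right
      rw [hG, Finset.mem_image]
      exact ⟨z, Finset.mem_filter.2 ⟨hTR (Finset.mem_singleton_self z), hTsum⟩, rfl⟩
    · -- `{x, y}`: `(1,3)`, `(3,1)` or `(2,2)`
      obtain ⟨x, y, hxy, rfl⟩ := Finset.card_eq_two.1 h2
      rw [Finset.sum_pair hxy] at hTsum
      have hx1 := hTa x (by simp)
      have hy1 := hTa y (by simp)
      have hxR : x ∈ Rf := hTR (by simp)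
      have hyR : y ∈ Rf := hTR (by simp)
      rcases (show (a x = 1 ∧ a y = 3) ∨ (a x = 3 ∧ a y = 1) ∨ (a x = 2 ∧ a y = 2) by omega) with
        ⟨hx, hy⟩ | ⟨hx, hy⟩ | ⟨hx, hy⟩
      · left; right
        rw [hF, Finset.mem_image]
        exact ⟨(x, y), Finset.mem_product.2 ⟨Finset.mem_filter.2 ⟨hxR, hx⟩, Finset.mem_filter.2 ⟨hyR, hy⟩⟩, rfl⟩
      · left; right
        rw [hF, Finset.mem_image]
        exact ⟨(y, x), Finset.mem_product.2 ⟨Finset.mem_filter.2 ⟨hyR, hy⟩, Finset.mem_filter.2 ⟨hxR, hx⟩⟩,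
          by simp only; rw [Finset.pair_comm]⟩
      · left; left; right
        rw [hD, Finset.mem_powersetCard]
        refine ⟨?_, h2⟩
        intro r hr
        rw [Finset.mem_insert, Finset.mem_singleton] at hr
        rcases hr with rfl | rfl
        · exact Finset.mem_filter.2 ⟨hxR, hx⟩
        · exact Finset.mem_filter.2 ⟨hyR, hy⟩
    · -- `{x, y, z}`: one weight `2`, two weights `1`
      obtain ⟨x, y, z, hxy, hxz, hyz, rfl⟩ := Finset.card_eq_three.1 h3
      have hxR : x ∈ Rf := hTR (by simp)
      have hyR : y ∈ Rf := hTR (by simp)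
      have hzR : z ∈ Rf := hTR (by simp)
      have hx1 := hTa x (by simp)
      have hy1 := hTa y (by simp)
      have hz1 := hTa z (by simp)
      have hsum3 : a x + a y + a z = 4 := by
        rw [Finset.sum_insert (by simp [hxy, hxz]), Finset.sum_pair hyz] at hTsum
        omega
      left; left; left; right
      rw [hB, Finset.mem_image]
      rcases (show (a x = 2 ∧ a y = 1 ∧ a z = 1) ∨ (a y = 2 ∧ a x = 1 ∧ a z = 1) ∨
          (a z = 2 ∧ a x = 1 ∧ a y = 1) by omega) with ⟨h2, h1, h1'⟩ | ⟨h2, h1, h1'⟩ | ⟨h2, h1, h1'⟩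
      · refine ⟨({y, z}, x), Finset.mem_product.2 ⟨Finset.mem_powersetCard.2 ⟨?_, Finset.card_pair hyz⟩,
          Finset.mem_filter.2 ⟨hxR, h2⟩⟩, rfl⟩
        intro r hr
        rw [Finset.mem_insert, Finset.mem_singleton] at hr
        rcases hr with rfl | rfl
        · exact Finset.mem_filter.2 ⟨hyR, h1⟩
        · exact Finset.mem_filter.2 ⟨hzR, h1'⟩
      · refine ⟨({x, z}, y), Finset.mem_product.2 ⟨Finset.mem_powersetCard.2 ⟨?_, Finset.card_pair hxz⟩,
          Finset.mem_filter.2 ⟨hyR, h2⟩⟩, ?_⟩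
        · intro r hr
          rw [Finset.mem_insert, Finset.mem_singleton] at hr
          rcases hr with rfl | rfl
          · exact Finset.mem_filter.2 ⟨hxR, h1⟩
          · exact Finset.mem_filter.2 ⟨hzR, h1'⟩
        · ext w; simp only [Finset.mem_insert, Finset.mem_singleton]; tauto
      · refine ⟨({x, y}, z), Finset.mem_product.2 ⟨Finset.mem_powersetCard.2 ⟨?_, Finset.card_pair hxy⟩,
          Finset.mem_filter.2 ⟨hzR, h2⟩⟩, ?_⟩
        · intro r hr
          rw [Finset.mem_insert, Finset.mem_singleton] at hr
          rcases hr with rfl | rfl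
          · exact Finset.mem_filter.2 ⟨hxR, h1⟩
          · exact Finset.mem_filter.2 ⟨hyR, h1'⟩
        · ext w; simp only [Finset.mem_insert, Finset.mem_singleton]; tauto
    · -- four weight-`1` elements
      left; left; left; left
      rw [hA, Finset.mem_powersetCard]
      refine ⟨?_, h4⟩
      intro r hr
      have hr1 := hTa r hr
      have hle : a r ≤ 1 := by
        have h := Finset.card_nsmul_le_sum (T.erase r) a 1 (fun s hs => hTa s (Finset.mem_of_mem_erase hs))
        rw [smul_eq_mul, mul_one, Finset.card_erase_of_mem hr, h4] at h
        have h' : 3 ≤ ∑ x ∈ T.erase r, a x := h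
        have hsplit : a r + ∑ x ∈ T.erase r, a x = ∑ x ∈ T, a x := Finset.add_sum_erase T a hr
        omega
      exact Finset.mem_filter.2 ⟨hTR hr, by omega⟩
  calc (Rf.powerset.filter (fun T => ∑ r ∈ T, a r = 4)).card
      ≤ ((((A ∪ B) ∪ D) ∪ F) ∪ G).card := Finset.card_le_card hsub
    _ ≤ (((A ∪ B) ∪ D) ∪ F).card + G.card := Finset.card_union_le _ _
    _ ≤ (((A ∪ B) ∪ D).card + F.card) + G.card := by gcongr; exact Finset.card_union_le _ _
    _ ≤ (((A ∪ B).card + D.card) + F.card) + G.card := by gcongr; exact Finset.card_union_le _ _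
    _ ≤ (((A.card + B.card) + D.card) + F.card) + G.card := by gcongr; exact Finset.card_union_le _ _
    _ ≤ (((R₁.card.choose 4 + (Finset.powersetCard 2 R₁ ×ˢ R₂).card) + R₂.card.choose 2) + (R₁ ×ˢ R₃).card) +
          R₄.card := by
        gcongr
        · rw [hA, Finset.card_powersetCard]
        · exact Finset.card_image_le
        · rw [hD, Finset.card_powersetCard]
        · exact Finset.card_image_le
        · exact Finset.card_image_le
    _ = _ := by rw [Finset.card_product, Finset.card_powersetCard, Finset.card_product]

end CoreFour
end PercRepro
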